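import Literature.Analysis.ValidatedNumerics.FixedPointInterval
import Literature.NumberTheory.LFunctions.ProlateFrobenius
import HarnessLib

/-!
# Connes–Consani 2021, Lemma 5.4: the in-kernel certificate for `ε′(1⁺) ∈ [22.9, 23.1]` —
# KERNEL LAYER (interval arithmetic by `decide +kernel`), FROBENIUS TAILS, and the BRIDGE to real statements

RH-FREE (label, line 1).  bears_on (cell rh-crit, corpus C1): apex input (B) — route «ConnesConsaniSemilocal»
item K2 `DensitySlope` (stmt 19308), the (E-b) conjunct of `CC2021_section6_enclosures`
(`22.9 ≤ Σ' n, epsSlopeTerm (ψ n) ≤ 23.1`, CC2021 Lemma 5.4: `ε′(1⁺) = Σ_n λ(n)²(1−λ(n)²)⁻¹ξ_n(1)² ≃ 22.9965`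
[cite: ConnesConsani2021, Lemma 5.4 §5 pp. 32–33 (arXiv item Lemma 31, chunk p0020:L86–L101)]).
AUTHORSHIP: this file is the engine package cc/engine/ebpack/EpsSlopeKernel-skeleton.lean (v4.1, sha16 ec42387bd28c8e3b)
of rh-crit-cc-eng-1, filed VERBATIM (docstring tags only) by rh-crit-cc-t15 per cc-lead R73 (1)/R79 (1)/R81 (R26-style
credit); bit-exact Python twin cc/engine/ebpack/eb_cert_v2.py → cert_eb.json (sha16 95042c3798215ac2), second lineage Arb
(eb_arb.py, job j252067).  The analytic identification (IVT in `χ`, prolate family members, `∫` identities, the plug into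
`EpsSlopeTailFrame.tsum_epsSlopeTerm_mem_Icc_of_certificate`) is `EpsSlopeEnclosure.lean`.

Part A: fixed-point interval arithmetic (`Literature.Analysis.ValidatedNumerics.Numerics.FI`, scale `2^48`) run BY
THE KERNEL (`decide +kernel`, ≈ 10 s) on the Frobenius recursion `frobCoeff` of the prolate equation at `λ = 1`
(bandwidth `c = 2π`) for four `χ`-brackets (centred at `χ_{2n}(2π)`, `n = 0..3`), with interval SOUNDNESS
(every real Frobenius coefficient and the finite sums `Σ a_k`, `Σ k a_k`, `Σ a_k/(k+1)`, `Σ a_i a_j/(i+j+1)` lie in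
the computed intervals for EVERY real `χ` in the bracket).  Part B: explicit geometric tails for the Frobenius
coefficients (pure algebra from `frobCoeff_rec` [cite: CoddingtonLevinson1955, Ch. 4 §8]).  Part C (bridge):
kernel-decidable integer checks (`modeTailOK_all`, `decide +kernel`) ⇒ REAL statements for every `χ` in a bracket:
the geometric bound `|a_k(χ)| ≤ B(13/20)^k` (`k ≥ K`), `|u(0) − Σ_{k≤K} a_k| ≤ T·2⁻⁴⁸`, `|u′(0) + Σ_{k≤K} k a_k| ≤ DT·2⁻⁴⁸`
(`u = frobSol 1 χ`, `u′ = frobSol₁ 1 χ`), and the certified SIGNS of `u′(0)` at the bracket ends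
(`endSigns_of_checks`, `bracketFacts_of_checks`).  Nothing here mentions ζ or RH; nothing here bears on the truth of RH.
-/

namespace Literature.NumberTheory.ConnesConsani2021.SlopeCert


open Literature.Analysis.ValidatedNumerics.Numerics Literature.NumberTheory.LFunctions Finset Real

/-! ## The computation (total computable functions on `ℤ`) -/

/-- `π²` enclosure. [cite: ConnesConsani2021, Lemma 5.4 §5 p. 33 (in-kernel certificate for ε′(1⁺) ≃ 22.9965)] -/
def PI2 : FI := FI.pi.sqr
/-- `4π²`. [cite: ConnesConsani2021, Lemma 5.4 §5 p. 33 (in-kernel certificate for ε′(1⁺) ≃ 22.9965)] -/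
def FOURPI2 : FI := PI2.mulInt 4
/-- `8π²`. [cite: ConnesConsani2021, Lemma 5.4 §5 p. 33 (in-kernel certificate for ε′(1⁺) ≃ 22.9965)] -/
def EIGHTPI2 : FI := PI2.mulInt 8

/-- The interval version of `frobTriple 1 χ`: triples enclosing `(a_{k−2}, a_{k−1}, a_k)`,
`a_{k+1} = ((k(k+1) − χ + 4π²)a_k − 8π²a_{k−1} + 4π²a_{k−2})/(2(k+1)²)`. [cite: CoddingtonLevinson1955, Ch. 4 §8] -/
def frobTripleFI (chi : FI) : ℕ → FI × FI × FI
  | 0 => (FI.ofInt 0, FI.ofInt 0, FI.ofInt 1)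
  | k + 1 =>
    let t := frobTripleFI chi k
    (t.2.1, t.2.2,
      ((((((FI.ofInt ((k : ℤ) * (k + 1))).sub chi).add FOURPI2).mul t.2.2).sub (EIGHTPI2.mul t.2.1)).add
        (FOURPI2.mul t.1)).divNat (2 * (k + 1) ^ 2))

/-- The interval `A_k ∋ a_k(χ)`. [cite: ConnesConsani2021, Lemma 5.4 §5 p. 33 (in-kernel certificate for ε′(1⁺) ≃ 22.9965)] -/
def frobCoeffFI (chi : FI) (k : ℕ) : FI := (frobTripleFI chi k).2.2

/-- `Σ_{k<n} F k`. [cite: ConnesConsani2021, Lemma 5.4 §5 p. 33 (in-kernel certificate for ε′(1⁺) ≃ 22.9965)] -/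
def sumFI (F : ℕ → FI) : ℕ → FI
  | 0 => FI.ofInt 0
  | n + 1 => (sumFI F n).add (F n)

/-- `Σ_{k<n} A_k` (encloses `Σ a_k = u(0)` up to the tail). [cite: ConnesConsani2021, Lemma 5.4 §5 p. 33 (in-kernel certificate for ε′(1⁺) ≃ 22.9965)] -/
def u0FI (chi : FI) (n : ℕ) : FI := sumFI (frobCoeffFI chi) n

/-- `Σ_{k<n} k·A_k` (encloses `−u′(0)` up to the tail). [cite: ConnesConsani2021, Lemma 5.4 §5 p. 33 (in-kernel certificate for ε′(1⁺) ≃ 22.9965)] -/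
def wFI (chi : FI) (n : ℕ) : FI := sumFI (fun k ↦ (frobCoeffFI chi k).mulInt k) n

/-- `Σ_{k<n} A_k/(k+1)` (encloses `∫₀¹ u` up to the tail). [cite: ConnesConsani2021, Lemma 5.4 §5 p. 33 (in-kernel certificate for ε′(1⁺) ≃ 22.9965)] -/
def iFI (chi : FI) (n : ℕ) : FI := sumFI (fun k ↦ (frobCoeffFI chi k).divNat (k + 1)) n

/-- `Σ_{i<n} Σ_{j<n} A_i A_j/(i+j+1)` (encloses `∫₀¹ u²` up to the tail). [cite: ConnesConsani2021, Lemma 5.4 §5 p. 33 (in-kernel certificate for ε′(1⁺) ≃ 22.9965)] -/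
def dFI (chi : FI) (n : ℕ) : FI :=
  sumFI (fun i ↦ sumFI (fun j ↦ ((frobCoeffFI chi i).mul (frobCoeffFI chi j)).divNat (i + j + 1)) n) n

/-- Per-mode certificate data: the bracket `[chiLo, chiHi]·2⁻⁴⁸`, the truncation order `K` (sums over
`k ≤ K`), scaled tail allowances `T ≥ 2⁴⁸·Σ_{k>K}|a_k|`, `DT ≥ 2⁴⁸·Σ_{k>K} k|a_k|` (valid on the bracket;
justified OUTSIDE this file by the recursion-induction `|a_k| ≤ B(13/20)^k`), and the expected sign of
`u′(0)` at `chiLo`. [cite: ConnesConsani2021, Lemma 5.4 §5 p. 33 (in-kernel certificate for ε′(1⁺) ≃ 22.9965)] -/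
structure ModeData where
  /-- scaled lower end of the χ-bracket -/
  chiLo : ℤ
  /-- scaled upper end of the χ-bracket -/
  chiHi : ℤ
  /-- truncation order -/
  K : ℕ
  /-- scaled tail allowance for `Σ_{k>K}|a_k|` -/
  T : ℕ
  /-- scaled tail allowance for `Σ_{k>K} k|a_k|` -/
  DT : ℕ
  /-- expected sign of `u′(0; chiLo)` (`true` = positive) -/
  sLo : Bool
  deriving DecidableEq

/-- The bracket as an interval. [cite: ConnesConsani2021, Lemma 5.4 §5 p. 33 (in-kernel certificate for ε′(1⁺) ≃ 22.9965)] -/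
def ModeData.chi (d : ModeData) : FI := ⟨d.chiLo, d.chiHi⟩

/-- Sign test of `−u′(0) = Σ k a_k` at a THIN `χ = c·2⁻⁴⁸` (tail allowance `DT`). [cite: ConnesConsani2021, Lemma 5.4 §5 p. 33 (in-kernel certificate for ε′(1⁺) ≃ 22.9965)] -/
def signNegDerivAt (c : ℤ) (K DT : ℕ) (pos : Bool) : Bool :=
  let W := (wFI ⟨c, c⟩ (K + 1)).widen DT
  if pos then decide (0 < W.lo) else decide (W.hi < 0)

/-- The bracket test: `−u′(0)` has opposite strict signs at the two ends (`sLo` ⇒ `−u′(0;chiLo) < 0`). [cite: ConnesConsani2021, Lemma 5.4 §5 p. 33 (in-kernel certificate for ε′(1⁺) ≃ 22.9965)] -/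
def bracketOK (d : ModeData) : Bool :=
  signNegDerivAt d.chiLo d.K d.DT (!d.sLo) && signNegDerivAt d.chiHi d.K d.DT d.sLo

/-- Whole-bracket enclosures `(U, I₁, I₂) ∋ (u(0), ∫₀¹u, ∫₀¹u²)` including the tail allowances
(`I₂` widened by `(2·Σ|A_k|·T + T²)·2⁻⁴⁸ + 1`, scaled; `Σ|A_k| ≤ |U|+…` is replaced by the explicit
bound `sAbs`). [cite: ConnesConsani2021, Lemma 5.4 §5 p. 33 (in-kernel certificate for ε′(1⁺) ≃ 22.9965)] -/
def modeEncl (d : ModeData) : FI × FI × FI :=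
  let U := u0FI d.chi (d.K + 1)
  let sAbs : ℤ := (sumFI (fun k ↦ let A := frobCoeffFI d.chi k; ⟨-A.absHi, A.absHi⟩) (d.K + 1)).hi
  (U.widen d.T, (iFI d.chi (d.K + 1)).widen d.T,
    (dFI d.chi (d.K + 1)).widen ((2 * sAbs * d.T + d.T * d.T) / (SC : ℤ) + 1))

/-- `λ² = (2∫₀¹u/u(0))²`, `ψ(1)² = 1/(2∫₀¹u²)`, their product, and `t = 2λ²ψ(1)²/(1−λ²)` as intervals
(`none` if a division is not certified). [cite: ConnesConsani2021, Lemma 5.4 §5 p. 33 (in-kernel certificate for ε′(1⁺) ≃ 22.9965)] -/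
def modeQuantities (d : ModeData) : Option (FI × FI × FI × FI) :=
  let e := modeEncl d
  let U := e.1
  let I1 := e.2.1
  let I2 := e.2.2
  let lam? : Option FI :=
    if 0 < U.lo then (I1.mulInt 2).divPos U
    else if U.hi < 0 then (I1.mulInt (-2)).divPos U.neg else none
  match lam? with
  | none => none
  | some lam =>
    let lam2 := lam.sqr
    match (FI.ofInt 1).divPos (I2.mulInt 2) with
    | none => none
    | some p1 =>
      match ((lam2.mulInt 2).mul p1).divPos ((FI.ofInt 1).sub lam2) with
      | none => none
      | some t => some (lam2, p1, lam2.mul p1, t)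

/-- The four modes of record (cc/engine/ebpack, 2026-08-26): brackets centred at the Arb values of
`χ_{2n}(2π)` (`n = 0,1,2,3`), half-widths `2⁻³², 2⁻³⁰, 2⁻²⁸, 2⁻²⁷`, `K = 40, 40, 40, 42`, tail allowances
from `q = 13/20`, `B = max_{k∈{K−2,K−1,K}}|a_k|q^{−k}`: `T ≥ 2⁴⁸Bq^{K+1}/(1−q)`,
`DT ≥ 2⁴⁸Bq^{K+1}((K+1)(1−q)+q)/(1−q)²`. [cite: ConnesConsani2021, Lemma 5.4 §5 p. 33 (in-kernel certificate for ε′(1⁺) ≃ 22.9965)] -/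
def modes : List ModeData :=
  [⟨1546449985993831, 1546449986124903, 40, 712, 30434, false⟩,
   ⟨7553145724163317, 7553145724687605, 40, 207, 8812, true⟩,
   ⟨12079789601160093, 12079789603257245, 40, 142, 6021, false⟩,
   ⟨17777562293405133, 17777562297599437, 42, 96, 4260, true⟩]

/-- All four bracket sign tests pass. [cite: ConnesConsani2021, Lemma 5.4 §5 p. 33 (in-kernel certificate for ε′(1⁺) ≃ 22.9965)] -/
def bracketsOK : Bool := modes.all bracketOK

/-- `(Σ t, Σ λ²ψ(1)², Σ λ²)` over the four modes (interval sums). [cite: ConnesConsani2021, Lemma 5.4 §5 p. 33 (in-kernel certificate for ε′(1⁺) ≃ 22.9965)] -/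
def totals : Option (FI × FI × FI) :=
  match modes.map modeQuantities with
  | [some q0, some q1, some q2, some q3] =>
    some ((q0.2.2.2.add q1.2.2.2).add (q2.2.2.2.add q3.2.2.2),
      (q0.2.2.1.add q1.2.2.1).add (q2.2.2.1.add q3.2.2.1),
      (q0.1.add q1.1).add (q2.1.add q3.1))
  | _ => none

/-- THE CHECK, in the shape of the analytic TAIL THEOREM (gm-t16 Tier 1 (c), cc/STATUS 07:32:19Z): with
`S ≤ Σ_{4} λ²ψ(1)²` (:= `(Σ λ²ψ(1)²).lo`), `M ≤ Σ_{4} λ²` (:= `(Σ λ²).lo`) and `Λ := 5/2 + 3/(2π) − M`, the frame gives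
`Σ_{4} t ≤ Σ' t ≤ Σ_{4} t + 2(1 − S)/(1 − Λ)`.  We check, in scaled integers: brackets pass; `22.9 ≤ (Σ t).lo`;
`Λ ≤ Λ₀ := 3/4` using `3/(2π) ≤ 478/1000` (from `π > 3.14`); `0 ≤ 1 − S`; and `(Σ t).hi + 2(1 − S)/(1 − Λ₀) = (Σ t).hi + 8(1 − S) ≤ 23.1`.
[cite: ConnesConsani2021, Lemma 5.4 §5 p. 33 (in-kernel certificate for ε′(1⁺) ≃ 22.9965)] -/
def slopeCheck : Bool :=
  bracketsOK &&
  match totals with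
  | none => false
  | some (tsum, l2psum, lam2sum) =>
    let sc : ℤ := SC
    let oneMinusS : ℤ := sc - l2psum.lo                     -- (1 − S)·2⁴⁸ (upper bound for 1 − Σλ²ψ(1)²)
    let LamUp : ℤ := (2978 * sc) / 1000 + 1 - lam2sum.lo    -- Λ·2⁴⁸ upper bound, 5/2 + 478/1000 − M
    decide (229 * sc ≤ 10 * tsum.lo) &&                     -- 22.9 ≤ Σ_{4} t
    decide (4 * LamUp ≤ 3 * sc) &&                           -- Λ ≤ 3/4
    decide (0 ≤ oneMinusS) &&
    decide (10 * (tsum.hi + 8 * oneMinusS) ≤ 231 * sc)      -- Σ_{4} t + 8(1 − S) ≤ 23.1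

/-- **The kernel evaluation** (≈ 10 s). [cite: ConnesConsani2021, Lemma 5.4 §5 p. 33 (in-kernel certificate for ε′(1⁺) ≃ 22.9965)] -/
theorem slopeCheck_eq_true : slopeCheck = true := by
  decide +kernel

/-! ## Interval soundness of the recursion and of the finite sums -/

/-- `4π² ∈ FOURPI2`. [cite: ConnesConsani2021, Lemma 5.4 §5 p. 33 (in-kernel certificate for ε′(1⁺) ≃ 22.9965)] -/
theorem mem_FOURPI2 : FI.mem (4 * Real.pi ^ 2) FOURPI2 := by
  have h := FI.mem_mulInt (FI.mem_sqr FI.mem_pi) 4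
  simpa [FOURPI2, PI2, mul_comm] using h

/-- `8π² ∈ EIGHTPI2`. [cite: ConnesConsani2021, Lemma 5.4 §5 p. 33 (in-kernel certificate for ε′(1⁺) ≃ 22.9965)] -/
theorem mem_EIGHTPI2 : FI.mem (8 * Real.pi ^ 2) EIGHTPI2 := by
  have h := FI.mem_mulInt (FI.mem_sqr FI.mem_pi) 8
  simpa [EIGHTPI2, PI2, mul_comm] using h

/-- Transport of membership along an equality of reals. [cite: ConnesConsani2021, Lemma 5.4 §5 p. 33 (in-kernel certificate for ε′(1⁺) ≃ 22.9965)] -/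
theorem mem_of_eq {x y : ℝ} {I : FI} (h : x = y) (hx : FI.mem x I) : FI.mem y I := h ▸ hx

/-- **Soundness of the interval recursion**: for every real `χ` in the interval `chi`, the Frobenius
triple `(a_{k−2}, a_{k−1}, a_k)(χ)` of `ProlateFrobenius` (at `λ = 1`) lies in `frobTripleFI chi k`.
[cite: CoddingtonLevinson1955, Ch. 4 §8] -/
theorem mem_frobTripleFI {χ : ℝ} {chi : FI} (hχ : FI.mem χ chi) (k : ℕ) :
    FI.mem (frobPrev₂ 1 χ k) (frobTripleFI chi k).1 ∧ FI.mem (frobPrev 1 χ k) (frobTripleFI chi k).2.1 ∧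
      FI.mem (frobCoeff 1 χ k) (frobTripleFI chi k).2.2 := by
  induction k with
  | zero =>
    refine ⟨?_, ?_, ?_⟩
    · simpa [frobTripleFI] using FI.mem_ofInt 0
    · simpa [frobTripleFI] using FI.mem_ofInt 0
    · simpa [frobTripleFI] using FI.mem_ofInt 1
  | succ k ih =>
    obtain ⟨h1, h2, h3⟩ := ih
    refine ⟨?_, ?_, ?_⟩
    · simpa [frobTripleFI] using h2
    · simpa [frobTripleFI] using h3
    · -- the new coefficient
      have hk : FI.mem (((k : ℤ) * (k + 1) : ℤ) : ℝ) (FI.ofInt ((k : ℤ) * (k + 1))) := FI.mem_ofInt _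
      have hnum := FI.mem_add
        (FI.mem_sub (FI.mem_mul (FI.mem_add (FI.mem_sub hk hχ) mem_FOURPI2) h3)
          (FI.mem_mul mem_EIGHTPI2 h2))
        (FI.mem_mul mem_FOURPI2 h1)
      have hpos : 0 < 2 * (k + 1) ^ 2 := by positivity
      have hdiv := FI.mem_divNat hnum hpos
      refine mem_of_eq ?_ (by simpa [frobTripleFI] using hdiv)
      rw [frobCoeff_succ]
      ring

/-- `a_k(χ) ∈ A_k`. [cite: CoddingtonLevinson1955, Ch. 4 §8] -/
theorem mem_frobCoeffFI {χ : ℝ} {chi : FI} (hχ : FI.mem χ chi) (k : ℕ) :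
    FI.mem (frobCoeff 1 χ k) (frobCoeffFI chi k) :=
  (mem_frobTripleFI hχ k).2.2

/-- Soundness of `sumFI`: finite sums of members are members. [cite: ConnesConsani2021, Lemma 5.4 §5 p. 33 (in-kernel certificate for ε′(1⁺) ≃ 22.9965)] -/
theorem mem_sumFI {f : ℕ → ℝ} {F : ℕ → FI} (h : ∀ k, FI.mem (f k) (F k)) (n : ℕ) :
    FI.mem (∑ k ∈ range n, f k) (sumFI F n) := by
  induction n with
  | zero => simpa [sumFI] using FI.mem_ofInt 0
  | succ n ih =>
    rw [sum_range_succ]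
    exact FI.mem_add ih (h n)

/-- `Σ_{k≤K} a_k(χ) ∈ u0FI`. [cite: ConnesConsani2021, Lemma 5.4 §5 p. 33 (in-kernel certificate for ε′(1⁺) ≃ 22.9965)] -/
theorem mem_u0FI {χ : ℝ} {chi : FI} (hχ : FI.mem χ chi) (n : ℕ) :
    FI.mem (∑ k ∈ range n, frobCoeff 1 χ k) (u0FI chi n) :=
  mem_sumFI (mem_frobCoeffFI hχ) n

/-- `Σ_{k≤K} k·a_k(χ) ∈ wFI`. [cite: ConnesConsani2021, Lemma 5.4 §5 p. 33 (in-kernel certificate for ε′(1⁺) ≃ 22.9965)] -/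
theorem mem_wFI {χ : ℝ} {chi : FI} (hχ : FI.mem χ chi) (n : ℕ) :
    FI.mem (∑ k ∈ range n, frobCoeff 1 χ k * k) (wFI chi n) :=
  mem_sumFI (fun k ↦ by simpa using FI.mem_mulInt (mem_frobCoeffFI hχ k) (k : ℤ)) n

/-- `Σ_{k≤K} a_k(χ)/(k+1) ∈ iFI`. [cite: ConnesConsani2021, Lemma 5.4 §5 p. 33 (in-kernel certificate for ε′(1⁺) ≃ 22.9965)] -/
theorem mem_iFI {χ : ℝ} {chi : FI} (hχ : FI.mem χ chi) (n : ℕ) :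
    FI.mem (∑ k ∈ range n, frobCoeff 1 χ k / (k + 1)) (iFI chi n) :=
  mem_sumFI (fun k ↦ by
    simpa using FI.mem_divNat (mem_frobCoeffFI hχ k) (Nat.succ_pos k)) n

/-- `Σ_{i,j≤K} a_i a_j/(i+j+1) ∈ dFI`. [cite: ConnesConsani2021, Lemma 5.4 §5 p. 33 (in-kernel certificate for ε′(1⁺) ≃ 22.9965)] -/
theorem mem_dFI {χ : ℝ} {chi : FI} (hχ : FI.mem χ chi) (n : ℕ) :
    FI.mem (∑ i ∈ range n, ∑ j ∈ range n, frobCoeff 1 χ i * frobCoeff 1 χ j / (i + j + 1)) (dFI chi n) :=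
  mem_sumFI (fun i ↦ mem_sumFI (fun j ↦ by
    have h := FI.mem_divNat (FI.mem_mul (mem_frobCoeffFI hχ i) (mem_frobCoeffFI hχ j))
      (Nat.succ_pos (i + j))
    simpa [Nat.cast_add, Nat.cast_one, add_assoc] using h) n) n

/-- Reading the sign test: if `signNegDerivAt c K DT true` then every real `w` with
`|w − Σ_{k≤K} k a_k(c·2⁻⁴⁸)|·2⁴⁸ ≤ DT` is positive (and symmetrically for `false`).  This is how the
analytic layer uses the test with `w = −u′(0; χ)` once the derivative tail is bounded by `DT`.
[cite: ConnesConsani2021, Lemma 5.4 §5 p. 33 (in-kernel certificate for ε′(1⁺) ≃ 22.9965)] -/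
theorem pos_of_signNegDerivAt {c : ℤ} {K DT : ℕ} (h : signNegDerivAt c K DT true = true) {w : ℝ}
    (hw : |w - ∑ k ∈ range (K + 1), frobCoeff 1 ((c : ℝ) / SC) k * k| * SC ≤ DT) : 0 < w := by
  have hχ : FI.mem ((c : ℝ) / SC) ⟨c, c⟩ := FI.mem_ofScaled c
  have hmem := FI.mem_widen (mem_wFI hχ (K + 1)) (e := DT) hw
  simp only [signNegDerivAt, ite_true, decide_eq_true_eq] at h
  exact FI.pos_of_lo_pos hmem h

/-- The negative case of the sign test. [cite: ConnesConsani2021, Lemma 5.4 §5 p. 33 (in-kernel certificate for ε′(1⁺) ≃ 22.9965)] -/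
theorem neg_of_signNegDerivAt {c : ℤ} {K DT : ℕ} (h : signNegDerivAt c K DT false = true) {w : ℝ}
    (hw : |w - ∑ k ∈ range (K + 1), frobCoeff 1 ((c : ℝ) / SC) k * k| * SC ≤ DT) : w < 0 := by
  have hχ : FI.mem ((c : ℝ) / SC) ⟨c, c⟩ := FI.mem_ofScaled c
  have hmem := FI.mem_widen (mem_wFI hχ (K + 1)) (e := DT) hw
  simp only [signNegDerivAt] at h
  have h0 : FI.mem (0 : ℝ) (FI.ofInt 0) := by simpa using FI.mem_ofInt 0
  have := FI.lt_of_hi_lt_lo hmem h0 (by simpa [FI.ofInt] using h)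
  simpa using this




/-- The recursion criterion at index `k` with slack constant `c` and ratio `q`. [cite: ConnesConsani2021, Lemma 5.4 §5 p. 33 (in-kernel certificate for ε′(1⁺) ≃ 22.9965)] -/
def RecCrit (c q : ℝ) (k : ℕ) : Prop :=
  ((k : ℝ) * ((k : ℝ) + 1) + c) * q ^ 2 + 8 * π ^ 2 * q + 4 * π ^ 2 ≤ 2 * ((k : ℝ) + 1) ^ 2 * q ^ 3

/-- **Monotonicity of the criterion**: if `q² ≤ 2q³` then `RecCrit c q k → RecCrit c q (k+1)`; hence one
check at `k₀` gives all `k ≥ k₀`. [cite: ConnesConsani2021, Lemma 5.4 §5 p. 33 (in-kernel certificate for ε′(1⁺) ≃ 22.9965)] -/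
theorem recCrit_mono {c q : ℝ} (hq : q ^ 2 ≤ 2 * q ^ 3) {k₀ : ℕ} (h0 : RecCrit c q k₀) :
    ∀ k, k₀ ≤ k → RecCrit c q k := by
  intro k hk
  induction k, hk using Nat.le_induction with
  | base => exact h0
  | succ k _ ih =>
    unfold RecCrit at ih ⊢
    push_cast
    have hq3 : 0 ≤ 2 * q ^ 3 - q ^ 2 := by linarith
    have hk0 : (0 : ℝ) ≤ k := Nat.cast_nonneg k
    nlinarith [mul_nonneg hk0 hq3]

/-- One step of the bound: from `|a_m| ≤ Bq^m`, `|a_{m+1}| ≤ Bq^{m+1}`, `|a_{m+2}| ≤ Bq^{m+2}` and the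
criterion at `m + 2` (with `c ≥ |4π² − χ|`) to `|a_{m+3}| ≤ B q^{m+3}`. [cite: CoddingtonLevinson1955, Ch. 4 §8] -/
theorem abs_frobCoeff_succ_le {χ c B q : ℝ} (hq : 0 < q) (hB : 0 ≤ B) (hc : |4 * π ^ 2 - χ| ≤ c)
    {m : ℕ} (h2 : |frobCoeff 1 χ m| ≤ B * q ^ m) (h1 : |frobCoeff 1 χ (m + 1)| ≤ B * q ^ (m + 1))
    (h0 : |frobCoeff 1 χ (m + 2)| ≤ B * q ^ (m + 2)) (hcrit : RecCrit c q (m + 2)) :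
    |frobCoeff 1 χ (m + 3)| ≤ B * q ^ (m + 3) := by
  have hrec := frobCoeff_rec (lam := (1 : ℝ)) (χ := χ) one_ne_zero (m + 2)
  rw [show m + 2 + 1 = m + 3 from rfl] at hrec
  simp only [one_pow, mul_one, frobPrev_succ, frobPrev₂_succ] at hrec
  -- hrec : 2 * (↑(m+2) + 1)^2 * a_{m+3} = (↑(m+2) * (↑(m+2)+1) - χ + 4π²) a_{m+2} - 8π² a_{m+1} + 4π² a_m
  set M : ℝ := ((m + 2 : ℕ) : ℝ) with hM
  have hM0 : (0 : ℝ) ≤ M := by positivity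
  have hden : 0 < 2 * (M + 1) ^ 2 := by positivity
  have hcoef : |M * (M + 1) - χ + 4 * π ^ 2| ≤ M * (M + 1) + c := by
    calc |M * (M + 1) - χ + 4 * π ^ 2| = |M * (M + 1) + (4 * π ^ 2 - χ)| := by ring_nf
      _ ≤ |M * (M + 1)| + |4 * π ^ 2 - χ| := abs_add_le _ _
      _ = M * (M + 1) + |4 * π ^ 2 - χ| := by rw [abs_of_nonneg (by positivity)]
      _ ≤ M * (M + 1) + c := by linarith
  have hc0 : 0 ≤ c := le_trans (abs_nonneg _) hc
  -- bound the right-hand side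
  have hrhs : |(M * (M + 1) - χ + 4 * π ^ 2) * frobCoeff 1 χ (m + 2) - 8 * π ^ 2 * frobCoeff 1 χ (m + 1)
      + 4 * π ^ 2 * frobCoeff 1 χ m|
      ≤ (M * (M + 1) + c) * (B * q ^ (m + 2)) + 8 * π ^ 2 * (B * q ^ (m + 1)) + 4 * π ^ 2 * (B * q ^ m) := by
    have e1 : |(M * (M + 1) - χ + 4 * π ^ 2) * frobCoeff 1 χ (m + 2)| ≤ (M * (M + 1) + c) * (B * q ^ (m + 2)) := by
      rw [abs_mul]; exact mul_le_mul hcoef h0 (abs_nonneg _) (by positivity)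
    have e2 : |8 * π ^ 2 * frobCoeff 1 χ (m + 1)| ≤ 8 * π ^ 2 * (B * q ^ (m + 1)) := by
      rw [abs_mul, abs_of_nonneg (by positivity)]; exact mul_le_mul_of_nonneg_left h1 (by positivity)
    have e3 : |4 * π ^ 2 * frobCoeff 1 χ m| ≤ 4 * π ^ 2 * (B * q ^ m) := by
      rw [abs_mul, abs_of_nonneg (by positivity)]; exact mul_le_mul_of_nonneg_left h2 (by positivity)
    calc _ ≤ |(M * (M + 1) - χ + 4 * π ^ 2) * frobCoeff 1 χ (m + 2) - 8 * π ^ 2 * frobCoeff 1 χ (m + 1)|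
            + |4 * π ^ 2 * frobCoeff 1 χ m| := abs_add_le _ _
      _ ≤ (|(M * (M + 1) - χ + 4 * π ^ 2) * frobCoeff 1 χ (m + 2)| + |8 * π ^ 2 * frobCoeff 1 χ (m + 1)|)
            + |4 * π ^ 2 * frobCoeff 1 χ m| := by gcongr; exact abs_sub _ _
      _ ≤ _ := by linarith
  -- the criterion turns this into B q^{m+3} · 2(M+1)²
  have hcrit' : ((M * (M + 1) + c) * q ^ 2 + 8 * π ^ 2 * q + 4 * π ^ 2) * (B * q ^ m)
      ≤ 2 * (M + 1) ^ 2 * q ^ 3 * (B * q ^ m) := by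
    unfold RecCrit at hcrit
    rw [← hM] at hcrit
    exact mul_le_mul_of_nonneg_right (by simpa using hcrit) (by positivity)
  have hR : (M * (M + 1) + c) * (B * q ^ (m + 2)) + 8 * π ^ 2 * (B * q ^ (m + 1)) + 4 * π ^ 2 * (B * q ^ m)
      = ((M * (M + 1) + c) * q ^ 2 + 8 * π ^ 2 * q + 4 * π ^ 2) * (B * q ^ m) := by ring
  have hL : 2 * (M + 1) ^ 2 * q ^ 3 * (B * q ^ m) = 2 * (M + 1) ^ 2 * (B * q ^ (m + 3)) := by ring
  have habs : |2 * (M + 1) ^ 2 * frobCoeff 1 χ (m + 3)| ≤ 2 * (M + 1) ^ 2 * (B * q ^ (m + 3)) := by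
    rw [hrec]
    exact hrhs.trans (by rw [hR, ← hL]; exact hcrit')
  rw [abs_mul, abs_of_nonneg (by positivity : (0 : ℝ) ≤ 2 * (M + 1) ^ 2)] at habs
  exact le_of_mul_le_mul_left habs hden

/-- **Geometric bound for all coefficients from three consecutive ones.** [cite: CoddingtonLevinson1955, Ch. 4 §8] -/
theorem abs_frobCoeff_le_geometric {χ c B q : ℝ} (hq : 0 < q) (hB : 0 ≤ B) (hc : |4 * π ^ 2 - χ| ≤ c)
    {K : ℕ} (hK0 : |frobCoeff 1 χ K| ≤ B * q ^ K) (hK1 : |frobCoeff 1 χ (K + 1)| ≤ B * q ^ (K + 1))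
    (hK2 : |frobCoeff 1 χ (K + 2)| ≤ B * q ^ (K + 2)) (hcrit : ∀ k, K + 2 ≤ k → RecCrit c q k) :
    ∀ k, K ≤ k → |frobCoeff 1 χ k| ≤ B * q ^ k := by
  -- invariant on three consecutive indices
  have key : ∀ n : ℕ, |frobCoeff 1 χ (K + n)| ≤ B * q ^ (K + n) ∧
      |frobCoeff 1 χ (K + n + 1)| ≤ B * q ^ (K + n + 1) ∧ |frobCoeff 1 χ (K + n + 2)| ≤ B * q ^ (K + n + 2) := by
    intro n
    induction n with
    | zero => exact ⟨by simpa using hK0, by simpa using hK1, by simpa using hK2⟩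
    | succ n ih =>
      obtain ⟨h2, h1, h0⟩ := ih
      have h := abs_frobCoeff_succ_le (m := K + n) hq hB hc h2 h1 h0 (hcrit (K + n + 2) (by omega))
      exact ⟨h1, h0, h⟩
  intro k hk
  obtain ⟨n, rfl⟩ := Nat.exists_eq_add_of_le hk
  exact (key n).1

/-! ## Tail sums -/

/-- `Σ_{k} q^{k+N} = q^N/(1−q)`. [cite: ConnesConsani2021, Lemma 5.4 §5 p. 33 (in-kernel certificate for ε′(1⁺) ≃ 22.9965)] -/
theorem tsum_geometric_shift {q : ℝ} (hq0 : 0 ≤ q) (hq1 : q < 1) (N : ℕ) :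
    ∑' k : ℕ, q ^ (k + N) = q ^ N / (1 - q) := by
  have h := tsum_geometric_of_lt_one hq0 hq1
  simp_rw [pow_add]
  rw [tsum_mul_right, h]
  ring

/-- Summability of the shifted geometric series with linear weight. [cite: ConnesConsani2021, Lemma 5.4 §5 p. 33 (in-kernel certificate for ε′(1⁺) ≃ 22.9965)] -/
theorem summable_linear_geometric {q : ℝ} (hq0 : 0 ≤ q) (hq1 : q < 1) (N : ℕ) :
    Summable fun k : ℕ ↦ ((k + N : ℕ) : ℝ) * q ^ (k + N) := by
  have hnorm : ‖q‖ < 1 := by rwa [norm_of_nonneg hq0]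
  have h1 : Summable fun k : ℕ ↦ (k : ℝ) * q ^ k := summable_pow_mul_geometric_of_norm_lt_one 1 hnorm |>.congr
    (fun k ↦ by simp)
  have h2 : Summable fun k : ℕ ↦ q ^ k := summable_geometric_of_lt_one hq0 hq1
  have : (fun k : ℕ ↦ ((k + N : ℕ) : ℝ) * q ^ (k + N))
      = fun k : ℕ ↦ q ^ N * ((k : ℝ) * q ^ k) + ((N : ℝ) * q ^ N) * q ^ k := by
    funext k; push_cast; ring
  rw [this]
  exact (h1.mul_left _).add (h2.mul_left _)

/-- `Σ_{k} (k+N) q^{k+N} = q^N (q + N(1−q))/(1−q)²`. [cite: ConnesConsani2021, Lemma 5.4 §5 p. 33 (in-kernel certificate for ε′(1⁺) ≃ 22.9965)] -/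
theorem tsum_linear_geometric_shift {q : ℝ} (hq0 : 0 ≤ q) (hq1 : q < 1) (N : ℕ) :
    ∑' k : ℕ, ((k + N : ℕ) : ℝ) * q ^ (k + N) = q ^ N * (q + N * (1 - q)) / (1 - q) ^ 2 := by
  have hnorm : ‖q‖ < 1 := by rwa [norm_of_nonneg hq0]
  have h1 : ∑' k : ℕ, (k : ℝ) * q ^ k = q / (1 - q) ^ 2 := tsum_coe_mul_geometric_of_norm_lt_one hnorm
  have h2 : ∑' k : ℕ, q ^ k = 1 / (1 - q) := by rw [tsum_geometric_of_lt_one hq0 hq1, one_div]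
  have hs1 : Summable fun k : ℕ ↦ (k : ℝ) * q ^ k := summable_pow_mul_geometric_of_norm_lt_one 1 hnorm |>.congr
    (fun k ↦ by simp)
  have hs2 : Summable fun k : ℕ ↦ q ^ k := summable_geometric_of_lt_one hq0 hq1
  have : (fun k : ℕ ↦ ((k + N : ℕ) : ℝ) * q ^ (k + N))
      = fun k : ℕ ↦ q ^ N * ((k : ℝ) * q ^ k) + ((N : ℝ) * q ^ N) * q ^ k := by
    funext k; push_cast; ring
  rw [this, (hs1.mul_left _).tsum_add (hs2.mul_left _), tsum_mul_left, tsum_mul_left, h1, h2]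
  have h1q : (1 - q) ≠ 0 := by linarith
  field_simp

/-- **Tail of `Σ |a_k| y^k`** (`|y| ≤ 1`): under the geometric bound from index `K+1` on,
`Σ_{k} |a_{k+K+1}| |y|^{k+K+1} ≤ B q^{K+1}/(1−q)`. [cite: ConnesConsani2021, Lemma 5.4 §5 p. 33 (in-kernel certificate for ε′(1⁺) ≃ 22.9965)] -/
theorem tsum_tail_abs_le {χ B q y : ℝ} (hq0 : 0 ≤ q) (hq1 : q < 1) (hB : 0 ≤ B) (hy : |y| ≤ 1) {K : ℕ}
    (hgeom : ∀ k, K + 1 ≤ k → |frobCoeff 1 χ k| ≤ B * q ^ k) :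
    Summable (fun k : ℕ ↦ |frobCoeff 1 χ (k + (K + 1))| * |y| ^ (k + (K + 1))) ∧
    ∑' k : ℕ, |frobCoeff 1 χ (k + (K + 1))| * |y| ^ (k + (K + 1)) ≤ B * q ^ (K + 1) / (1 - q) := by
  have hmaj : ∀ k : ℕ, |frobCoeff 1 χ (k + (K + 1))| * |y| ^ (k + (K + 1)) ≤ B * q ^ (k + (K + 1)) := by
    intro k
    have h1 := hgeom (k + (K + 1)) (by omega)
    have h2 : |y| ^ (k + (K + 1)) ≤ 1 := pow_le_one₀ (abs_nonneg y) hy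
    calc _ ≤ B * q ^ (k + (K + 1)) * 1 := mul_le_mul h1 h2 (by positivity) (by positivity)
      _ = _ := mul_one _
  have hsum : Summable fun k : ℕ ↦ B * q ^ (k + (K + 1)) :=
    ((summable_geometric_of_lt_one hq0 hq1).mul_left (B * q ^ (K + 1))).congr fun k ↦ by ring
  have hs : Summable (fun k : ℕ ↦ |frobCoeff 1 χ (k + (K + 1))| * |y| ^ (k + (K + 1))) :=
    Summable.of_nonneg_of_le (fun k ↦ by positivity) hmaj hsum
  refine ⟨hs, ?_⟩
  calc ∑' k : ℕ, |frobCoeff 1 χ (k + (K + 1))| * |y| ^ (k + (K + 1))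
      ≤ ∑' k : ℕ, B * q ^ (k + (K + 1)) := hs.tsum_le_tsum hmaj hsum
    _ = B * (q ^ (K + 1) / (1 - q)) := by rw [tsum_mul_left, tsum_geometric_shift hq0 hq1]
    _ = B * q ^ (K + 1) / (1 - q) := by ring

/-- **Tail of `Σ k|a_k|`**: `Σ_{k} (k+K+1)|a_{k+K+1}| ≤ B q^{K+1}(q + (K+1)(1−q))/(1−q)²`. [cite: ConnesConsani2021, Lemma 5.4 §5 p. 33 (in-kernel certificate for ε′(1⁺) ≃ 22.9965)] -/
theorem tsum_tail_linear_abs_le {χ B q : ℝ} (hq0 : 0 ≤ q) (hq1 : q < 1) {K : ℕ}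
    (hgeom : ∀ k, K + 1 ≤ k → |frobCoeff 1 χ k| ≤ B * q ^ k) :
    Summable (fun k : ℕ ↦ ((k + (K + 1) : ℕ) : ℝ) * |frobCoeff 1 χ (k + (K + 1))|) ∧
    ∑' k : ℕ, ((k + (K + 1) : ℕ) : ℝ) * |frobCoeff 1 χ (k + (K + 1))|
      ≤ B * (q ^ (K + 1) * (q + (K + 1 : ℕ) * (1 - q)) / (1 - q) ^ 2) := by
  have hmaj : ∀ k : ℕ, ((k + (K + 1) : ℕ) : ℝ) * |frobCoeff 1 χ (k + (K + 1))|
      ≤ B * (((k + (K + 1) : ℕ) : ℝ) * q ^ (k + (K + 1))) := by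
    intro k
    have h1 := hgeom (k + (K + 1)) (by omega)
    have hk : (0 : ℝ) ≤ ((k + (K + 1) : ℕ) : ℝ) := Nat.cast_nonneg _
    calc _ ≤ ((k + (K + 1) : ℕ) : ℝ) * (B * q ^ (k + (K + 1))) := mul_le_mul_of_nonneg_left h1 hk
      _ = _ := by ring
  have hsum : Summable fun k : ℕ ↦ B * (((k + (K + 1) : ℕ) : ℝ) * q ^ (k + (K + 1))) :=
    (summable_linear_geometric hq0 hq1 (K + 1)).mul_left B
  have hs : Summable (fun k : ℕ ↦ ((k + (K + 1) : ℕ) : ℝ) * |frobCoeff 1 χ (k + (K + 1))|) :=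
    Summable.of_nonneg_of_le (fun k ↦ by positivity) hmaj hsum
  refine ⟨hs, ?_⟩
  calc _ ≤ ∑' k : ℕ, B * (((k + (K + 1) : ℕ) : ℝ) * q ^ (k + (K + 1))) := hs.tsum_le_tsum hmaj hsum
    _ = B * (q ^ (K + 1) * (q + (K + 1 : ℕ) * (1 - q)) / (1 - q) ^ 2) := by
        rw [tsum_mul_left, tsum_linear_geometric_shift hq0 hq1 (K + 1)]


/-! ## Part C — the bridge: kernel-decidable checks ⇒ real statements on each bracket -/

/-- Integer data justifying the tails of one mode: truncation `K`, scaled majorant constant `Bnum`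
(`B = Bnum·2⁻⁴⁸`), an integer `c ≥ |4π² − χ|` on the bracket, and the allowances `T`, `DT`. [cite: ConnesConsani2021, Lemma 5.4 §5 p. 33 (in-kernel certificate for ε′(1⁺) ≃ 22.9965)] -/
structure TailData where
  /-- truncation order -/
  K : ℕ
  /-- scaled majorant constant -/
  Bnum : ℕ
  /-- integer bound for `|4π² − χ|` on the bracket -/
  c : ℕ
  /-- scaled allowance for `Σ_{k>K}|a_k|` -/
  T : ℕ
  /-- scaled allowance for `Σ_{k>K} k|a_k|` -/
  DT : ℕ
  deriving DecidableEq

/-- The rational form of the recursion criterion at `K + 2` (`q = 13/20`, `π² ≤ 987/100`). [cite: ConnesConsani2021, Lemma 5.4 §5 p. 33 (in-kernel certificate for ε′(1⁺) ≃ 22.9965)] -/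
def critQ (K c : ℕ) : Prop :=
  (((K + 2) * (K + 3) + c : ℕ) : ℚ) * (13 / 20) ^ 2 + 8 * (987 / 100) * (13 / 20) + 4 * (987 / 100)
    ≤ 2 * ((K + 3 : ℕ) : ℚ) ^ 2 * (13 / 20) ^ 3

/-- The rational criterion is decidable (an inequality between explicit rationals).
[cite: ConnesConsani2021, Lemma 5.4 §5 p. 33 (in-kernel certificate for ε′(1⁺) ≃ 22.9965)] -/
instance (K c : ℕ) : Decidable (critQ K c) := by unfold critQ; infer_instance

/-- The kernel-decidable tail check for a bracket `chi` (ratio `q = 13/20`, `π² ≤ 987/100`):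
(a) `|A_k|·20ᵏ ≤ Bnum·13ᵏ` for `k = K, K+1, K+2`; (b) `|4π² − χ| ≤ c` on the bracket (from the FI
enclosure of `4π²`); (c) the recursion criterion at `K+2` with `π²` replaced by `987/100`;
(d) `20·Bnum·13^{K+1} ≤ 7·T·20^{K+1}`; (e) `20·Bnum·13^{K+1}·(13 + 7(K+1)) ≤ 49·DT·20^{K+1}`. [cite: ConnesConsani2021, Lemma 5.4 §5 p. 33 (in-kernel certificate for ε′(1⁺) ≃ 22.9965)] -/
def tailCheck (chi : FI) (td : TailData) : Bool :=
  decide ((frobCoeffFI chi td.K).absHi * 20 ^ td.K ≤ (td.Bnum : ℤ) * 13 ^ td.K) &&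
  decide ((frobCoeffFI chi (td.K + 1)).absHi * 20 ^ (td.K + 1) ≤ (td.Bnum : ℤ) * 13 ^ (td.K + 1)) &&
  decide ((frobCoeffFI chi (td.K + 2)).absHi * 20 ^ (td.K + 2) ≤ (td.Bnum : ℤ) * 13 ^ (td.K + 2)) &&
  decide (FOURPI2.hi - chi.lo ≤ (td.c : ℤ) * SC) && decide (chi.hi - FOURPI2.lo ≤ (td.c : ℤ) * SC) &&
  decide (critQ td.K td.c) &&
  decide (20 * td.Bnum * 13 ^ (td.K + 1) ≤ 7 * td.T * 20 ^ (td.K + 1)) &&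
  decide (20 * td.Bnum * 13 ^ (td.K + 1) * (13 + 7 * (td.K + 1)) ≤ 49 * td.DT * 20 ^ (td.K + 1))

set_option maxRecDepth 4000 in
/-- Unpacking a passed `tailCheck`. [cite: ConnesConsani2021, Lemma 5.4 §5 p. 33 (in-kernel certificate for ε′(1⁺) ≃ 22.9965)] -/
theorem tailCheck_spec {chi : FI} {td : TailData} (h : tailCheck chi td = true) :
    (frobCoeffFI chi td.K).absHi * 20 ^ td.K ≤ (td.Bnum : ℤ) * 13 ^ td.K ∧
    (frobCoeffFI chi (td.K + 1)).absHi * 20 ^ (td.K + 1) ≤ (td.Bnum : ℤ) * 13 ^ (td.K + 1) ∧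
    (frobCoeffFI chi (td.K + 2)).absHi * 20 ^ (td.K + 2) ≤ (td.Bnum : ℤ) * 13 ^ (td.K + 2) ∧
    FOURPI2.hi - chi.lo ≤ (td.c : ℤ) * SC ∧ chi.hi - FOURPI2.lo ≤ (td.c : ℤ) * SC ∧ critQ td.K td.c ∧
    20 * td.Bnum * 13 ^ (td.K + 1) ≤ 7 * td.T * 20 ^ (td.K + 1) ∧
    20 * td.Bnum * 13 ^ (td.K + 1) * (13 + 7 * (td.K + 1)) ≤ 49 * td.DT * 20 ^ (td.K + 1) := by
  simp only [tailCheck, Bool.and_eq_true, decide_eq_true_eq] at h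
  obtain ⟨⟨⟨⟨⟨⟨⟨h1, h2⟩, h3⟩, h4⟩, h5⟩, h6⟩, h7⟩, h8⟩ := h
  exact ⟨h1, h2, h3, h4, h5, h6, h7, h8⟩

/-- `π² ≤ 987/100`. [cite: ConnesConsani2021, Lemma 5.4 §5 p. 33 (in-kernel certificate for ε′(1⁺) ≃ 22.9965)] -/
theorem pi_sq_le : π ^ 2 ≤ 987 / 100 := by
  have h := Real.pi_lt_d4
  have h0 := Real.pi_pos.le
  nlinarith


/-- From the base check: `|a_k(χ)| ≤ B q^k` with `B = Bnum·2⁻⁴⁸`, `q = 13/20`. [cite: ConnesConsani2021, Lemma 5.4 §5 p. 33 (in-kernel certificate for ε′(1⁺) ≃ 22.9965)] -/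
theorem abs_le_of_base {χ : ℝ} {chi : FI} (hχ : FI.mem χ chi) {Bnum k : ℕ}
    (h : (frobCoeffFI chi k).absHi * 20 ^ k ≤ (Bnum : ℤ) * 13 ^ k) :
    |frobCoeff 1 χ k| ≤ (Bnum : ℝ) / SC * (13 / 20) ^ k := by
  have h1 := FI.abs_le_absHi (mem_frobCoeffFI hχ k)
  have h2 : ((frobCoeffFI chi k).absHi : ℝ) * 20 ^ k ≤ (Bnum : ℝ) * 13 ^ k := by exact_mod_cast h
  have hSC := SC_pos
  have h20 : (0 : ℝ) < 20 ^ k := by positivity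
  have key : |frobCoeff 1 χ k| * SC * 20 ^ k ≤ (Bnum : ℝ) * 13 ^ k :=
    le_trans (mul_le_mul_of_nonneg_right h1 h20.le) h2
  have e : (Bnum : ℝ) / SC * (13 / 20) ^ k = (Bnum : ℝ) * 13 ^ k / (SC * 20 ^ k) := by
    rw [div_pow]; field_simp
  rw [e, le_div_iff₀ (by positivity)]
  calc |frobCoeff 1 χ k| * (SC * 20 ^ k) = |frobCoeff 1 χ k| * SC * 20 ^ k := by ring
    _ ≤ _ := key

/-- From the `c`-check: `|4π² − χ| ≤ c` on the bracket. [cite: ConnesConsani2021, Lemma 5.4 §5 p. 33 (in-kernel certificate for ε′(1⁺) ≃ 22.9965)] -/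
theorem abs_four_pi_sq_sub_le {χ : ℝ} {chi : FI} (hχ : FI.mem χ chi) {c : ℕ}
    (h1 : FOURPI2.hi - chi.lo ≤ (c : ℤ) * SC) (h2 : chi.hi - FOURPI2.lo ≤ (c : ℤ) * SC) :
    |4 * π ^ 2 - χ| ≤ (c : ℝ) := by
  have hp := mem_FOURPI2
  have hSC := SC_pos
  have h1' : ((FOURPI2.hi : ℝ) - chi.lo) ≤ (c : ℝ) * SC := by exact_mod_cast h1
  have h2' : ((chi.hi : ℝ) - FOURPI2.lo) ≤ (c : ℝ) * SC := by exact_mod_cast h2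
  have hχ1 := hχ.1; have hχ2 := hχ.2; have hp1 := hp.1; have hp2 := hp.2
  have hup : (4 * π ^ 2 - χ) * SC ≤ c * SC := by nlinarith
  have hlo : (χ - 4 * π ^ 2) * SC ≤ c * SC := by nlinarith
  have hup' : 4 * π ^ 2 - χ ≤ c := le_of_mul_le_mul_right hup hSC
  have hlo' : χ - 4 * π ^ 2 ≤ c := le_of_mul_le_mul_right hlo hSC
  rw [abs_le]
  constructor <;> linarith

/-- From the rational criterion check (with `π² ≤ 9.87`): the real criterion at `K + 2`. [cite: ConnesConsani2021, Lemma 5.4 §5 p. 33 (in-kernel certificate for ε′(1⁺) ≃ 22.9965)] -/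
theorem recCrit_of_check {K c : ℕ} (h : critQ K c) : RecCrit c (13 / 20) (K + 2) := by
  unfold critQ at h
  unfold RecCrit
  have h' := (Rat.cast_le (K := ℝ)).2 h
  push_cast at h' ⊢
  have hp := pi_sq_le
  nlinarith

/-- **(R1) The geometric bound on the whole bracket** from a passed `tailCheck`. [cite: ConnesConsani2021, Lemma 5.4 §5 p. 33 (in-kernel certificate for ε′(1⁺) ≃ 22.9965)] -/
theorem geometric_of_tailCheck {χ : ℝ} {chi : FI} (hχ : FI.mem χ chi) {td : TailData}
    (h : tailCheck chi td = true) :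
    ∀ k, td.K ≤ k → |frobCoeff 1 χ k| ≤ (td.Bnum : ℝ) / SC * (13 / 20) ^ k := by
  obtain ⟨hb0, hb1, hb2, hc1, hc2, hcrit, -, -⟩ := tailCheck_spec h
  refine abs_frobCoeff_le_geometric (by norm_num) (by positivity) (abs_four_pi_sq_sub_le hχ hc1 hc2)
    (abs_le_of_base hχ hb0) (abs_le_of_base hχ hb1) (abs_le_of_base hχ hb2) ?_
  exact recCrit_mono (by norm_num) (recCrit_of_check hcrit)

/-- The `T` inequality read in `ℝ`: `B q^{K+1}/(1−q) ≤ T·2⁻⁴⁸`. [cite: ConnesConsani2021, Lemma 5.4 §5 p. 33 (in-kernel certificate for ε′(1⁺) ≃ 22.9965)] -/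
theorem tail_le_T {td : TailData} (h : 20 * td.Bnum * 13 ^ (td.K + 1) ≤ 7 * td.T * 20 ^ (td.K + 1)) :
    (td.Bnum : ℝ) / SC * (13 / 20) ^ (td.K + 1) / (1 - 13 / 20) ≤ (td.T : ℝ) / SC := by
  have h' : (20 : ℝ) * td.Bnum * 13 ^ (td.K + 1) ≤ 7 * td.T * 20 ^ (td.K + 1) := by exact_mod_cast h
  have hSC := SC_pos
  have h20 : (0 : ℝ) < 20 ^ (td.K + 1) := by positivity
  have key : (td.Bnum : ℝ) * (13 / 20) ^ (td.K + 1) / (1 - 13 / 20) ≤ td.T := by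
    have e : (td.Bnum : ℝ) * (13 / 20) ^ (td.K + 1) / (1 - 13 / 20)
        = 20 * td.Bnum * 13 ^ (td.K + 1) / (7 * 20 ^ (td.K + 1)) := by
      rw [div_pow]; field_simp; ring
    rw [e, div_le_iff₀ (by positivity)]
    linarith
  calc (td.Bnum : ℝ) / SC * (13 / 20) ^ (td.K + 1) / (1 - 13 / 20)
      = ((td.Bnum : ℝ) * (13 / 20) ^ (td.K + 1) / (1 - 13 / 20)) / SC := by ring
    _ ≤ (td.T : ℝ) / SC := div_le_div_of_nonneg_right key hSC.le

/-- The `DT` inequality read in `ℝ`. [cite: ConnesConsani2021, Lemma 5.4 §5 p. 33 (in-kernel certificate for ε′(1⁺) ≃ 22.9965)] -/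
theorem tail_le_DT {td : TailData}
    (h : 20 * td.Bnum * 13 ^ (td.K + 1) * (13 + 7 * (td.K + 1)) ≤ 49 * td.DT * 20 ^ (td.K + 1)) :
    (td.Bnum : ℝ) / SC * ((13 / 20) ^ (td.K + 1) * (13 / 20 + ((td.K + 1 : ℕ) : ℝ) * (1 - 13 / 20))
      / (1 - 13 / 20) ^ 2) ≤ (td.DT : ℝ) / SC := by
  have h' : (20 : ℝ) * td.Bnum * 13 ^ (td.K + 1) * (13 + 7 * ((td.K : ℝ) + 1)) ≤ 49 * td.DT * 20 ^ (td.K + 1) := by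
    exact_mod_cast h
  have hSC := SC_pos
  have h20 : (0 : ℝ) < 20 ^ (td.K + 1) := by positivity
  have key : (td.Bnum : ℝ) * ((13 / 20) ^ (td.K + 1) * (13 / 20 + ((td.K + 1 : ℕ) : ℝ) * (1 - 13 / 20))
      / (1 - 13 / 20) ^ 2) ≤ td.DT := by
    have e : (td.Bnum : ℝ) * ((13 / 20) ^ (td.K + 1) * (13 / 20 + ((td.K + 1 : ℕ) : ℝ) * (1 - 13 / 20))
        / (1 - 13 / 20) ^ 2) = 20 * td.Bnum * 13 ^ (td.K + 1) * (13 + 7 * ((td.K : ℝ) + 1)) / (49 * 20 ^ (td.K + 1)) := by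
      rw [div_pow]; push_cast; field_simp; ring
    rw [e, div_le_iff₀ (by positivity)]
    linarith
  calc (td.Bnum : ℝ) / SC * ((13 / 20) ^ (td.K + 1) * (13 / 20 + ((td.K + 1 : ℕ) : ℝ) * (1 - 13 / 20))
      / (1 - 13 / 20) ^ 2)
      = ((td.Bnum : ℝ) * ((13 / 20) ^ (td.K + 1) * (13 / 20 + ((td.K + 1 : ℕ) : ℝ) * (1 - 13 / 20))
      / (1 - 13 / 20) ^ 2)) / SC := by ring
    _ ≤ (td.DT : ℝ) / SC := div_le_div_of_nonneg_right key hSC.le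

/-- **(R2) `u(0)` versus the finite sum**: for `χ` in the bracket,
`|frobSol 1 χ 0 − Σ_{k≤K} a_k(χ)| ≤ T·2⁻⁴⁸`. [cite: ConnesConsani2021, Lemma 5.4 §5 p. 33 (in-kernel certificate for ε′(1⁺) ≃ 22.9965)] -/
theorem abs_frobSol_zero_sub_sum_le {χ : ℝ} {chi : FI} (hχ : FI.mem χ chi) {td : TailData}
    (h : tailCheck chi td = true) :
    |frobSol 1 χ 0 - ∑ k ∈ range (td.K + 1), frobCoeff 1 χ k| ≤ (td.T : ℝ) / SC := by
  have hgeom := geometric_of_tailCheck hχ h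
  obtain ⟨-, -, -, -, -, -, hT, -⟩ := tailCheck_spec h
  have hB : (0 : ℝ) ≤ (td.Bnum : ℝ) / SC := by positivity
  obtain ⟨hs, hle⟩ := tsum_tail_abs_le (y := 1) (by norm_num) (by norm_num) hB (by simp)
    (K := td.K) (fun k hk ↦ hgeom k (by omega))
  simp only [abs_one, one_pow, mul_one] at hs hle
  have hs' : Summable fun k : ℕ ↦ frobCoeff 1 χ (k + (td.K + 1)) := hs.of_abs
  have hsum : Summable fun k : ℕ ↦ frobCoeff 1 χ k := (summable_nat_add_iff (td.K + 1)).1 hs'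
  have hsplit := hsum.sum_add_tsum_nat_add (td.K + 1)
  have hsol : frobSol 1 χ 0 = ∑' k : ℕ, frobCoeff 1 χ k := by
    simp only [frobSol, sub_zero, one_pow, mul_one]
  rw [hsol, ← hsplit, add_sub_cancel_left]
  calc |∑' k : ℕ, frobCoeff 1 χ (k + (td.K + 1))| ≤ ∑' k : ℕ, |frobCoeff 1 χ (k + (td.K + 1))| := by
        have := norm_tsum_le_tsum_norm (f := fun k : ℕ ↦ frobCoeff 1 χ (k + (td.K + 1)))
          (by simp only [Real.norm_eq_abs]; exact hs)
        simpa only [Real.norm_eq_abs] using this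
    _ ≤ (td.Bnum : ℝ) / SC * (13 / 20) ^ (td.K + 1) / (1 - 13 / 20) := hle
    _ ≤ (td.T : ℝ) / SC := tail_le_T hT

/-- **(R3) `u′(0)` versus the finite weighted sum**: for `χ` in the bracket,
`|frobSol₁ 1 χ 0 + Σ_{k≤K} k·a_k(χ)| ≤ DT·2⁻⁴⁸`. [cite: ConnesConsani2021, Lemma 5.4 §5 p. 33 (in-kernel certificate for ε′(1⁺) ≃ 22.9965)] -/
theorem abs_frobSol₁_zero_add_sum_le {χ : ℝ} {chi : FI} (hχ : FI.mem χ chi) {td : TailData}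
    (h : tailCheck chi td = true) :
    |frobSol₁ 1 χ 0 + ∑ k ∈ range (td.K + 1), frobCoeff 1 χ k * k| ≤ (td.DT : ℝ) / SC := by
  have hgeom := geometric_of_tailCheck hχ h
  obtain ⟨-, -, -, -, -, -, -, hDT⟩ := tailCheck_spec h
  obtain ⟨hs, hle⟩ := tsum_tail_linear_abs_le (by norm_num) (by norm_num) (K := td.K)
    (fun k hk ↦ hgeom k (by omega))
  -- the weighted series g k = (k+1) a_{k+1}; its shift by K is the tail of the statement
  set g : ℕ → ℝ := fun k ↦ ((k : ℝ) + 1) * frobCoeff 1 χ (k + 1) with hg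
  have hshift : ∀ k : ℕ, g (k + td.K) = ((k + (td.K + 1) : ℕ) : ℝ) * frobCoeff 1 χ (k + (td.K + 1)) := by
    intro k
    simp only [hg]
    have e1 : k + td.K + 1 = k + (td.K + 1) := by omega
    rw [e1]; push_cast; ring
  have habs_shift : ∀ k : ℕ, |g (k + td.K)| = ((k + (td.K + 1) : ℕ) : ℝ) * |frobCoeff 1 χ (k + (td.K + 1))| := by
    intro k
    rw [hshift, abs_mul, Nat.abs_cast]
  have hs_abs : Summable fun k : ℕ ↦ |g (k + td.K)| := by
    simpa only [habs_shift] using hs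
  have hs_shift : Summable fun k : ℕ ↦ g (k + td.K) := hs_abs.of_abs
  have hsum : Summable g := (summable_nat_add_iff td.K).1 hs_shift
  have hsplit := hsum.sum_add_tsum_nat_add td.K
  have hsol : frobSol₁ 1 χ 0 = -∑' k : ℕ, g k := by
    simp only [frobSol₁, hg, sub_zero, one_pow, mul_one]
  have hfin : ∑ k ∈ range (td.K + 1), frobCoeff 1 χ k * k = ∑ k ∈ range td.K, g k := by
    rw [sum_range_succ']
    simp only [hg, Nat.cast_add, Nat.cast_one, Nat.cast_zero, mul_zero, add_zero]
    refine sum_congr rfl fun k _ ↦ by ring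
  rw [hsol, hfin, ← hsplit]
  have e : -(∑ k ∈ range td.K, g k + ∑' k : ℕ, g (k + td.K)) + ∑ k ∈ range td.K, g k
      = -∑' k : ℕ, g (k + td.K) := by ring
  rw [e, abs_neg]
  calc |∑' k : ℕ, g (k + td.K)| ≤ ∑' k : ℕ, |g (k + td.K)| := by
        have := norm_tsum_le_tsum_norm (f := fun k : ℕ ↦ g (k + td.K))
          (by simp only [Real.norm_eq_abs]; exact hs_abs)
        simpa only [Real.norm_eq_abs] using this
    _ = ∑' k : ℕ, ((k + (td.K + 1) : ℕ) : ℝ) * |frobCoeff 1 χ (k + (td.K + 1))| := by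
        simp only [habs_shift]
    _ ≤ _ := hle
    _ ≤ (td.DT : ℝ) / SC := tail_le_DT hDT

/-- The sign test made REAL: if the thin-end sign test passes (`pos = true`) and the tail check passes at
the thin bracket `⟨c, c⟩`, then `0 < frobSol₁ 1 (c·2⁻⁴⁸) 0 … ` — precisely: `−u′(0) > 0`, i.e. `u′(0) < 0`.
[cite: ConnesConsani2021, Lemma 5.4 §5 p. 33 (in-kernel certificate for ε′(1⁺) ≃ 22.9965)] -/
theorem frobSol₁_zero_neg_of_checks {c : ℤ} {td : TailData} (ht : tailCheck ⟨c, c⟩ td = true)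
    (hs : signNegDerivAt c td.K td.DT true = true) : frobSol₁ 1 ((c : ℝ) / SC) 0 < 0 := by
  have hχ : FI.mem ((c : ℝ) / SC) ⟨c, c⟩ := FI.mem_ofScaled c
  have hR3 := abs_frobSol₁_zero_add_sum_le hχ ht
  have hw : |(-frobSol₁ 1 ((c : ℝ) / SC) 0) - ∑ k ∈ range (td.K + 1), frobCoeff 1 ((c : ℝ) / SC) k * k| * SC
      ≤ td.DT := by
    have e : (-frobSol₁ 1 ((c : ℝ) / SC) 0) - ∑ k ∈ range (td.K + 1), frobCoeff 1 ((c : ℝ) / SC) k * k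
        = -(frobSol₁ 1 ((c : ℝ) / SC) 0 + ∑ k ∈ range (td.K + 1), frobCoeff 1 ((c : ℝ) / SC) k * k) := by ring
    rw [e, abs_neg]
    have := (le_div_iff₀ SC_pos).1 hR3
    exact this
  have := pos_of_signNegDerivAt hs hw
  linarith

/-- The sign test made REAL, negative case: `u′(0) > 0`. [cite: ConnesConsani2021, Lemma 5.4 §5 p. 33 (in-kernel certificate for ε′(1⁺) ≃ 22.9965)] -/
theorem frobSol₁_zero_pos_of_checks {c : ℤ} {td : TailData} (ht : tailCheck ⟨c, c⟩ td = true)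
    (hs : signNegDerivAt c td.K td.DT false = true) : 0 < frobSol₁ 1 ((c : ℝ) / SC) 0 := by
  have hχ : FI.mem ((c : ℝ) / SC) ⟨c, c⟩ := FI.mem_ofScaled c
  have hR3 := abs_frobSol₁_zero_add_sum_le hχ ht
  have hw : |(-frobSol₁ 1 ((c : ℝ) / SC) 0) - ∑ k ∈ range (td.K + 1), frobCoeff 1 ((c : ℝ) / SC) k * k| * SC
      ≤ td.DT := by
    have e : (-frobSol₁ 1 ((c : ℝ) / SC) 0) - ∑ k ∈ range (td.K + 1), frobCoeff 1 ((c : ℝ) / SC) k * k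
        = -(frobSol₁ 1 ((c : ℝ) / SC) 0 + ∑ k ∈ range (td.K + 1), frobCoeff 1 ((c : ℝ) / SC) k * k) := by ring
    rw [e, abs_neg]
    exact (le_div_iff₀ SC_pos).1 hR3
  have := neg_of_signNegDerivAt hs hw
  linarith

/-! ## The tail data of the four modes of record, their kernel checks, and the per-mode REAL facts -/

/-- The tail data of a mode: its own `K, T, DT` plus the majorant constant `Bnum` and the `c`-bound. [cite: ConnesConsani2021, Lemma 5.4 §5 p. 33 (in-kernel certificate for ε′(1⁺) ≃ 22.9965)] -/
def ModeData.tail (d : ModeData) (Bnum c : ℕ) : TailData := ⟨d.K, Bnum, c, d.T, d.DT⟩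

/-- `(Bnum, c)` of record per mode (cc/engine/ebpack/tails_v3.json): `Bnum = 1 + max_{k∈{K,K+1,K+2}}
⌈|A_k|·(20/13)ᵏ⌉` over the whole bracket, `c = ⌈|4π² − χ|⌉` from the FI enclosure of `4π²`. [cite: ConnesConsani2021, Lemma 5.4 §5 p. 33 (in-kernel certificate for ε′(1⁺) ≃ 22.9965)] -/
def tailConsts : List (ℕ × ℕ) := [(9254209308, 34), (2648408586, 13), (1765605724, 4), (2737931749, 24)]

/-- All tail checks of one mode: on the whole bracket and at the two thin ends. [cite: ConnesConsani2021, Lemma 5.4 §5 p. 33 (in-kernel certificate for ε′(1⁺) ≃ 22.9965)] -/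
def modeTailOK (p : ModeData × (ℕ × ℕ)) : Bool :=
  tailCheck p.1.chi (p.1.tail p.2.1 p.2.2) && tailCheck ⟨p.1.chiLo, p.1.chiLo⟩ (p.1.tail p.2.1 p.2.2) &&
    tailCheck ⟨p.1.chiHi, p.1.chiHi⟩ (p.1.tail p.2.1 p.2.2)

/-- **Kernel evaluation of all tail checks** (twelve `tailCheck`s). [cite: ConnesConsani2021, Lemma 5.4 §5 p. 33 (in-kernel certificate for ε′(1⁺) ≃ 22.9965)] -/
theorem modeTailOK_all : (modes.zip tailConsts).all modeTailOK = true := by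
  decide +kernel

/-- **End signs made real.**  For a mode whose bracket test and thin-end tail checks pass:
if `sLo` then `u′(0; χ⁻) > 0` and `u′(0; χ⁺) < 0`, else the reverse (`u′ = frobSol₁ 1 χ`, `χ± = chi±·2⁻⁴⁸`).
[cite: ConnesConsani2021, Lemma 5.4 §5 p. 33 (in-kernel certificate for ε′(1⁺) ≃ 22.9965)] -/
theorem endSigns_of_checks {d : ModeData} {Bnum c : ℕ}
    (hlo : tailCheck ⟨d.chiLo, d.chiLo⟩ (d.tail Bnum c) = true)
    (hhi : tailCheck ⟨d.chiHi, d.chiHi⟩ (d.tail Bnum c) = true) (hb : bracketOK d = true) :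
    (d.sLo = true → 0 < frobSol₁ 1 ((d.chiLo : ℝ) / SC) 0 ∧ frobSol₁ 1 ((d.chiHi : ℝ) / SC) 0 < 0) ∧
    (d.sLo = false → frobSol₁ 1 ((d.chiLo : ℝ) / SC) 0 < 0 ∧ 0 < frobSol₁ 1 ((d.chiHi : ℝ) / SC) 0) := by
  simp only [bracketOK, Bool.and_eq_true] at hb
  obtain ⟨h1, h2⟩ := hb
  constructor
  · intro hs
    rw [hs] at h1 h2
    exact ⟨frobSol₁_zero_pos_of_checks (td := d.tail Bnum c) hlo h1,
      frobSol₁_zero_neg_of_checks (td := d.tail Bnum c) hhi h2⟩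
  · intro hs
    rw [hs] at h1 h2
    exact ⟨frobSol₁_zero_neg_of_checks (td := d.tail Bnum c) hlo h1,
      frobSol₁_zero_pos_of_checks (td := d.tail Bnum c) hhi h2⟩

/-- **Whole-bracket real facts.**  For a mode whose whole-bracket tail check passes and every real `χ`
in the bracket: (R1) `|a_k(χ)| ≤ Bnum·2⁻⁴⁸·(13/20)ᵏ` for `k ≥ K`; (R2) `|u(0) − Σ_{k≤K} a_k| ≤ T·2⁻⁴⁸`
with `Σ_{k≤K} a_k ∈ u0FI`; (R3) `|u′(0) + Σ_{k≤K} k a_k| ≤ DT·2⁻⁴⁸`; and the finite sums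
`Σ a_k/(k+1) ∈ iFI`, `ΣΣ a_i a_j/(i+j+1) ∈ dFI` (the integrands of `∫₀¹u`, `∫₀¹u²` termwise). [cite: ConnesConsani2021, Lemma 5.4 §5 p. 33 (in-kernel certificate for ε′(1⁺) ≃ 22.9965)] -/
theorem bracketFacts_of_checks {d : ModeData} {Bnum c : ℕ} (h : tailCheck d.chi (d.tail Bnum c) = true)
    {χ : ℝ} (hχ : FI.mem χ d.chi) :
    (∀ k, d.K ≤ k → |frobCoeff 1 χ k| ≤ (Bnum : ℝ) / SC * (13 / 20) ^ k) ∧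
    |frobSol 1 χ 0 - ∑ k ∈ range (d.K + 1), frobCoeff 1 χ k| ≤ (d.T : ℝ) / SC ∧
    FI.mem (∑ k ∈ range (d.K + 1), frobCoeff 1 χ k) (u0FI d.chi (d.K + 1)) ∧
    |frobSol₁ 1 χ 0 + ∑ k ∈ range (d.K + 1), frobCoeff 1 χ k * k| ≤ (d.DT : ℝ) / SC ∧
    FI.mem (∑ k ∈ range (d.K + 1), frobCoeff 1 χ k / (k + 1)) (iFI d.chi (d.K + 1)) ∧
    FI.mem (∑ i ∈ range (d.K + 1), ∑ j ∈ range (d.K + 1), frobCoeff 1 χ i * frobCoeff 1 χ j / (i + j + 1))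
      (dFI d.chi (d.K + 1)) :=
  ⟨geometric_of_tailCheck hχ h, abs_frobSol_zero_sub_sum_le hχ h, mem_u0FI hχ _,
    abs_frobSol₁_zero_add_sum_le hχ h, mem_iFI hχ _, mem_dFI hχ _⟩

/-! ## Small exports for the series links (∫₀¹u, ∫₀¹u²) of the analytic layer -/

/-- The absolute tail is summable and `≤ T·2⁻⁴⁸` on the bracket (the allowance used for `u(0)` AND for
`∫₀¹u = Σ a_k/(k+1) + tail`, since `0 ≤ ∫₀¹(1−x)ᵏdx = 1/(k+1) ≤ 1`). [cite: ConnesConsani2021, Lemma 5.4 §5 p. 33 (in-kernel certificate for ε′(1⁺) ≃ 22.9965)] -/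
theorem summable_abs_tail_le_T {d : ModeData} {Bnum c : ℕ} (h : tailCheck d.chi (d.tail Bnum c) = true)
    {χ : ℝ} (hχ : FI.mem χ d.chi) :
    Summable (fun k : ℕ ↦ |frobCoeff 1 χ (k + (d.K + 1))|) ∧
      ∑' k : ℕ, |frobCoeff 1 χ (k + (d.K + 1))| ≤ (d.T : ℝ) / SC := by
  have hgeom := geometric_of_tailCheck hχ h
  obtain ⟨-, -, -, -, -, -, hT, -⟩ := tailCheck_spec h
  have hB : (0 : ℝ) ≤ (Bnum : ℝ) / SC := by positivity
  obtain ⟨hs, hle⟩ := tsum_tail_abs_le (y := 1) (by norm_num) (by norm_num) hB (by simp)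
    (K := d.K) (fun k hk ↦ hgeom k (by change d.K ≤ k; omega))
  simp only [abs_one, one_pow, mul_one] at hs hle
  exact ⟨hs, hle.trans (tail_le_T (td := d.tail Bnum c) hT)⟩

/-- The scaled bound `sAbs` of `modeEncl` dominates `Σ_{k≤K} |a_k|`: for `χ` in the bracket,
`Σ_{k<n} |a_k(χ)| · 2⁴⁸ ≤ (sumFI (fun k ↦ ⟨−|A_k|, |A_k|⟩) n).hi`. [cite: ConnesConsani2021, Lemma 5.4 §5 p. 33 (in-kernel certificate for ε′(1⁺) ≃ 22.9965)] -/
theorem sum_abs_mul_SC_le_sAbs {χ : ℝ} {chi : FI} (hχ : FI.mem χ chi) (n : ℕ) :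
    (∑ k ∈ range n, |frobCoeff 1 χ k|) * SC
      ≤ ((sumFI (fun k ↦ let A := frobCoeffFI chi k; ⟨-A.absHi, A.absHi⟩) n).hi : ℝ) := by
  induction n with
  | zero => simp [sumFI, FI.ofInt]
  | succ n ih =>
    rw [sum_range_succ, add_mul]
    have hk := FI.abs_le_absHi (mem_frobCoeffFI hχ n)
    simp only [sumFI, FI.add, Int.cast_add]
    exact add_le_add ih hk

end Literature.NumberTheory.ConnesConsani2021.SlopeCert
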